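import Literature.Probability.Percolation.OneArmArcTail
import Literature.Probability.Percolation.OneArmNeumannCouplingLinear
import HarnessLib

/-!
# The one-arm facts of Lawler–Schramm–Werner from (2.10) at the joint subsequential limits (proofs only)

Topic `Literature/Probability/Percolation`; family `crit-perc`. Def-free, fact-free assembly of
`OneArmArcHulls.lean` (the discrete arc hulls `Q_δ(θ)` anchored at `-i` and the joint laws
`lswPairLaw R θ` of `(Q_δ(θ), Q_δ(2π))`), `OneArmArcTail.lean` (the tail
`P[Q_δ(2π) ⊄ Q_δ(θ) ∪ B̄(-i, r)] ≤ c (2π - θ)/r` eventually in `R`, from the half-plane two-arm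
bound), `OneArmArcCouplingLimit.lean` (portmanteau transfer to weak limits) and
`OneArmNeumannCouplingLinear.lean` (the identification of the trace from arc couplings with tail
exponent `γ > 1/2`), about the named facts `LawlerSchrammWerner2002_hittingPDE`,
`LawlerSchrammWerner2002_scalingLimitExponent` (LSW Thm. 1.2) and `oneArm_exponent` (LSW Thm. 1.1) of
Lawler–Schramm–Werner, *One-arm exponent for critical 2D percolation*, Electron. J. Probab. **7**
(2002), paper no. 2.

* `map_snd_lswPairLaw'` — the second marginal of `lswPairLaw R θ` is `lswLaw R` (bundled form);
  `exists_tendsto_subseq_lswPairLaw` — joint subsequential weak limits exist (Prokhorov);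
* `arcCoupling_of_subseq` — **the arc couplings at the subsequential limits**: if `R_k → ∞` and
  `lswLaw (R_k) → ν`, then for every `θ` any weak limit `μ` of `lswPairLaw (R_{φ(k)}) θ` along a
  subsequence has second marginal `ν`, `K_θ ⊆ K_{2π}` a.s., and the tail
  `μ{K_{2π} ⊄ K_θ ∪ B̄(-i, r)} ≤ c (2π - θ)/r` for all `r > 0` (`θ < 2π`), with the absolute `c` of
  `lswPairLaw_real_not_subset_eventually_le`;
* `exists_arcCouplings_of_pairLimit_renewal`, `lswHit_two_pi_eq_measureReal_of_pairLimit_renewal` — the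
  arc couplings, and the trace identification `u(2π, t) = ν{𝔯 ≤ e^{-t}}` at EVERY subsequential weak
  limit `ν` of `lswLaw`, from (2.10) at the joint subsequential limits;
* `oneArm_exponent_of_pairLimit_renewal` — **MAIN**: the three LSW facts hold as soon as LSW's
  (2.10) holds at the joint subsequential limits: for every `θ ∈ (0, 2π)`, every `R_k → ∞` and
  every weak limit `μ` of `lswPairLaw (R_k) θ`,
  `μ{𝔯(K_θ) ≤ e^{-s}} = renewalST 6 1_{≤0} w_μ θ s` for all `s`, where
  `w_μ(s) = μ{𝔯(K_{2π}) ≤ e^{-s}}` is the trace of the second marginal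
  (`oneArm_exponent_of_subseqArcCoupling_linear'` with `ζ = -i`, `γ = 1`);
  `LawlerSchrammWerner2002_hittingPDE_of_pairLimit_renewal` — the named fact alone.

So what is left of LSW §2 for `LawlerSchrammWerner2002_hittingPDE` (and for Thm. 1.2, Thm. 1.1 by
this route) is exactly LSW's Theorem 2.1 (Smirnov: the law of `Q(θ)` through chordal `SLE₆` and
conformal invariance of the full scaling limit) combined with the radial `SLE₆` computation
(2.5)–(2.9) (chordal–radial equivalence up to the disconnection time, `𝔯 = e^{-T}`,
`Y_T ∈ {0, 2π}`), in the form of the renewal identity (2.10) for the arc hulls at the joint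
subsequential limits. No harmonic measure ((2.15)), no three-arm bound ((2.13)) and no existence
of the full scaling limit are needed. No new definitions, no named facts.

## References

* G. F. Lawler, O. Schramm, W. Werner, *One-arm exponent for critical 2D percolation*, Electron.
  J. Probab. 7 (2002), no. 2: Thm. 1.1, Thm. 1.2, §2 (Thm. 2.1, (2.2), (2.10), Lemma 2.2,
  Lemma 2.3 (2.12)–(2.16)), §3 [LawlerSchrammWernerEJP2002].
* P. Billingsley, *Convergence of Probability Measures*, 2nd ed. (1999), Thm. 2.1, Thm. 5.1
  [Billingsley1999].

## Mathlib / tree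

Tree: `lswPairLaw`, `map_snd_lswPairLaw`, `ae_fst_subset_snd_lswPairLaw`,
`lswPairLaw_compl_prod_subUnitDisc` (`OneArmArcHulls`), `lswPairLaw_real_not_subset_eventually_le`
(`OneArmArcTail`), `exists_tendsto_subseq_pairLaw`, `oneArm_exponent_of_subseqArcCoupling_linear'`
(`OneArmNeumannCoupling`, `OneArmNeumannCouplingLinear`), `map_snd_eq_of_tendsto`,
`ae_fst_subset_snd_of_tendsto`, `measureReal_not_snd_subset_fst_union_le_of_tendsto`
(`OneArmArcCouplingLimit`), `measurable_conformalRadius_nonemptyCompacts`. Mathlib: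
`ProbabilityMeasure.toMeasure_injective`, `StrictMono.tendsto_atTop`, `Real.rpow_one`,
`map_measureReal_apply`.
-/

noncomputable section

open MeasureTheory Filter Topology Set Metric TopologicalSpace Complex
open Literature.Probability.LatticeModels Literature.Analysis.Complex
  Literature.Probability.RandomPlanarGeometry Literature.Probability.RandomPlanarGeometry.RadialLoewner

namespace Literature.Probability.Percolation

/-- The second marginal of the joint law of `(Q_δ(θ), Q_δ(2π))` is the law of `Q_δ(2π)`, as bundled
probability measures. [cite: LawlerSchrammWernerEJP2002, §2 (p. 3)] -/
theorem map_snd_lswPairLaw' (R θ : ℝ) :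
    (lswPairLaw R θ).map (f := Prod.snd) continuous_snd.measurable.aemeasurable = lswLaw R := by
  apply ProbabilityMeasure.toMeasure_injective
  rw [ProbabilityMeasure.toMeasure_map]
  exact map_snd_lswPairLaw R θ

/-- **Joint subsequential limits of `(Q_δ(θ), Q_δ(2π))` exist** along any sequence of meshes
(Prokhorov on the compact `subUnitDisc ×ˢ subUnitDisc`, `exists_tendsto_subseq_pairLaw`).
[cite: LawlerSchrammWernerEJP2002, §2 (p. 3)] [cite: Billingsley1999, Thm. 5.1] -/
theorem exists_tendsto_subseq_lswPairLaw (R : ℕ → ℝ) (θ : ℝ) :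
    ∃ μ : ProbabilityMeasure (NonemptyCompacts ℂ × NonemptyCompacts ℂ), ∃ φ : ℕ → ℕ, StrictMono φ ∧
      Tendsto (fun k ↦ lswPairLaw (R (φ k)) θ) atTop (𝓝 μ) :=
  exists_tendsto_subseq_pairLaw (fun k ↦ lswPairLaw (R k) θ) fun k ↦ lswPairLaw_compl_prod_subUnitDisc (R k) θ

/-- **The arc couplings at the subsequential limits.** Let `c` be the constant of
`lswPairLaw_real_not_subset_eventually_le`. If `R_k → ∞`, `lswLaw (R_k) → ν` weakly, `φ` is strictly
increasing and `lswPairLaw (R_{φ(k)}) θ → μ` weakly, then `μ` has second marginal `ν`,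
`K_θ ⊆ K_{2π}` `μ`-a.s., and, if `θ < 2π`, `μ{K_{2π} ⊄ K_θ ∪ B̄(-i, r)} ≤ c (2π - θ)/r` for every
`r > 0` (portmanteau: `map_snd_eq_of_tendsto`, `ae_fst_subset_snd_of_tendsto`,
`measureReal_not_snd_subset_fst_union_le_of_tendsto`). [cite: LawlerSchrammWernerEJP2002, §2 (p. 3), (2.13)–(2.14) (p. 6)] -/
theorem arcCoupling_of_subseq {c : ℝ}
    (hc : ∀ θ r : ℝ, θ < 2 * Real.pi → 0 < r → ∀ᶠ R : ℝ in atTop,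
      (lswPairLaw R θ : Measure (NonemptyCompacts ℂ × NonemptyCompacts ℂ)).real
          {p | ¬ (((p.2 : NonemptyCompacts ℂ) : Set ℂ) ⊆ (p.1 : Set ℂ) ∪ closedBall (-I) r)} ≤
        c * ((2 * Real.pi - θ) / r))
    {R : ℕ → ℝ} {ν : ProbabilityMeasure (NonemptyCompacts ℂ)} (hR : Tendsto R atTop atTop)
    (hν : Tendsto (lswLaw ∘ R) atTop (𝓝 ν)) {θ : ℝ} {φ : ℕ → ℕ} (hφ : StrictMono φ)
    {μ : ProbabilityMeasure (NonemptyCompacts ℂ × NonemptyCompacts ℂ)}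
    (hμ : Tendsto (fun k ↦ lswPairLaw (R (φ k)) θ) atTop (𝓝 μ)) :
    (μ : Measure (NonemptyCompacts ℂ × NonemptyCompacts ℂ)).map Prod.snd = ν ∧
    (∀ᵐ p ∂(μ : Measure (NonemptyCompacts ℂ × NonemptyCompacts ℂ)),
      ((p.1 : NonemptyCompacts ℂ) : Set ℂ) ⊆ (p.2 : Set ℂ)) ∧
    (θ < 2 * Real.pi → ∀ r : ℝ, 0 < r → (μ : Measure (NonemptyCompacts ℂ × NonemptyCompacts ℂ)).real
      {p | ¬ (((p.2 : NonemptyCompacts ℂ) : Set ℂ) ⊆ (p.1 : Set ℂ) ∪ closedBall (-I) r)} ≤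
        c * ((2 * Real.pi - θ) / r)) := by
  have hRφ : Tendsto (R ∘ φ) atTop atTop := hR.comp hφ.tendsto_atTop
  refine ⟨map_snd_eq_of_tendsto hμ ?_, ae_fst_subset_snd_of_tendsto hμ fun k ↦ ae_fst_subset_snd_lswPairLaw _ _,
    fun hθ r hr ↦ measureReal_not_snd_subset_fst_union_le_of_tendsto hμ ((hRφ.eventually (hc θ r hθ hr)))⟩
  have : (fun k ↦ (lswPairLaw (R (φ k)) θ).map (f := Prod.snd) continuous_snd.measurable.aemeasurable) =
      lswLaw ∘ R ∘ φ := by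
    funext k
    exact map_snd_lswPairLaw' _ _
  rw [this]
  exact hν.comp hφ.tendsto_atTop

/-- **Arc couplings with (2.10) at a subsequential limit.** If `R_k → ∞`, `lswLaw (R_k) → ν`, and
LSW's (2.10) holds at the joint subsequential limits (hypothesis `h210`, see
`oneArm_exponent_of_pairLimit_renewal`), then `ν` admits, for `θ ∈ (0, 2π)`, couplings `μ_θ` of
`(K_θ, K_{2π})` with second marginal `ν`, `K_θ ⊆ K_{2π}` a.s., (2.10) for the first marginal with
the trace `w_ν`, and tails `μ_θ{K_{2π} ⊄ K_θ ∪ B̄(-i, r)} ≤ c (2π - θ)/r` (`θ < 2π`, `r > 0`) — the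
hypotheses of `renewal_hypotheses_of_arcCoupling_linear` with `ζ = -i`, `γ = 1`.
[cite: LawlerSchrammWernerEJP2002, §2: Thm. 2.1, (2.10), (2.13)–(2.14)] -/
theorem exists_arcCouplings_of_pairLimit_renewal
    (h210 : ∀ (θ : ℝ) (R : ℕ → ℝ) (μ : ProbabilityMeasure (NonemptyCompacts ℂ × NonemptyCompacts ℂ)),
      θ ∈ Ioo 0 (2 * Real.pi) → Tendsto R atTop atTop → Tendsto (fun k ↦ lswPairLaw (R k) θ) atTop (𝓝 μ) →
      ∀ s : ℝ, (μ : Measure (NonemptyCompacts ℂ × NonemptyCompacts ℂ)).real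
          {p | conformalRadius ((p.1 : NonemptyCompacts ℂ) : Set ℂ) ≤ Real.exp (-s)} =
        renewalST 6 bottomDatum (fun s ↦ (μ : Measure (NonemptyCompacts ℂ × NonemptyCompacts ℂ)).real
          {p | conformalRadius ((p.2 : NonemptyCompacts ℂ) : Set ℂ) ≤ Real.exp (-s)}) θ s)
    {R : ℕ → ℝ} {ν : ProbabilityMeasure (NonemptyCompacts ℂ)} (hR : Tendsto R atTop atTop)
    (hν : Tendsto (lswLaw ∘ R) atTop (𝓝 ν)) :
    ∃ c : ℝ, ∃ μ : ℝ → ProbabilityMeasure (NonemptyCompacts ℂ × NonemptyCompacts ℂ),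
      (∀ θ ∈ Ioo 0 (2 * Real.pi),
        (μ θ : Measure (NonemptyCompacts ℂ × NonemptyCompacts ℂ)).map Prod.snd = ν) ∧
      (∀ θ ∈ Ioo 0 (2 * Real.pi), ∀ᵐ p ∂(μ θ : Measure (NonemptyCompacts ℂ × NonemptyCompacts ℂ)),
        ((p.1 : NonemptyCompacts ℂ) : Set ℂ) ⊆ (p.2 : Set ℂ)) ∧
      (∀ θ ∈ Ioo 0 (2 * Real.pi), ∀ s : ℝ,
        (μ θ : Measure (NonemptyCompacts ℂ × NonemptyCompacts ℂ)).real
            {p | conformalRadius ((p.1 : NonemptyCompacts ℂ) : Set ℂ) ≤ Real.exp (-s)} =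
          renewalST 6 bottomDatum (fun s ↦ (ν : Measure (NonemptyCompacts ℂ)).real
            {K | conformalRadius (K : Set ℂ) ≤ Real.exp (-s)}) θ s) ∧
      (∀ θ ∈ Ioo 0 (2 * Real.pi), ∀ r : ℝ, 0 < r →
        (μ θ : Measure (NonemptyCompacts ℂ × NonemptyCompacts ℂ)).real
            {p | ¬ (((p.2 : NonemptyCompacts ℂ) : Set ℂ) ⊆ (p.1 : Set ℂ) ∪ closedBall (-I) r)} ≤
          c * ((2 * Real.pi - θ) / r)) := by
  obtain ⟨c, -, hc⟩ := lswPairLaw_real_not_subset_eventually_le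
  -- joint subsequential limits for every `θ`
  have key : ∀ θ : ℝ, ∃ μ : ProbabilityMeasure (NonemptyCompacts ℂ × NonemptyCompacts ℂ), ∃ φ : ℕ → ℕ,
      StrictMono φ ∧ Tendsto (fun k ↦ lswPairLaw (R (φ k)) θ) atTop (𝓝 μ) :=
    fun θ ↦ exists_tendsto_subseq_lswPairLaw R θ
  choose μ φ hφ hμ using key
  have hcoup : ∀ θ, _ := fun θ ↦ arcCoupling_of_subseq hc hR hν (hφ θ) (hμ θ)
  refine ⟨c, μ, fun θ _ ↦ (hcoup θ).1, fun θ _ ↦ (hcoup θ).2.1, fun θ hθ s ↦ ?_,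
    fun θ hθ r hr ↦ (hcoup θ).2.2 hθ.2 r hr⟩
  -- (2.10) at the joint subsequential limit, with the trace of the second marginal `= w_ν`
  rw [h210 θ (R ∘ φ θ) (μ θ) hθ (hR.comp (hφ θ).tendsto_atTop) (hμ θ) s]
  congr 1
  funext s'
  have hS : MeasurableSet {K : NonemptyCompacts ℂ | conformalRadius (K : Set ℂ) ≤ Real.exp (-s')} :=
    measurableSet_le measurable_conformalRadius_nonemptyCompacts measurable_const
  have := map_measureReal_apply (μ := (μ θ : Measure (NonemptyCompacts ℂ × NonemptyCompacts ℂ)))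
    measurable_snd hS
  rw [(hcoup θ).1] at this
  rw [this]
  rfl

/-- **The trace identification at every subsequential weak limit, from (2.10) at the joint
subsequential limits**: if `R_k → ∞` and `lswLaw (R_k) → ν`, then `u(2π, t) = ν{K | 𝔯(K) ≤ e^{-t}}`
for all `t > 0` (`u = lswHit 6`): LSW's identification `h(2π, ·) =` the explicit solution, here
without the existence of the full scaling limit (`lswHit_two_pi_eq_measureReal_of_arcCoupling_linear`,
`ae_conformalRadius_pos_of_subseqLimit`). [cite: LawlerSchrammWernerEJP2002, §2: Thm. 2.1, (2.2), (2.10), Lemma 2.2, Lemma 2.3, (2.17)] -/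
theorem lswHit_two_pi_eq_measureReal_of_pairLimit_renewal
    (h210 : ∀ (θ : ℝ) (R : ℕ → ℝ) (μ : ProbabilityMeasure (NonemptyCompacts ℂ × NonemptyCompacts ℂ)),
      θ ∈ Ioo 0 (2 * Real.pi) → Tendsto R atTop atTop → Tendsto (fun k ↦ lswPairLaw (R k) θ) atTop (𝓝 μ) →
      ∀ s : ℝ, (μ : Measure (NonemptyCompacts ℂ × NonemptyCompacts ℂ)).real
          {p | conformalRadius ((p.1 : NonemptyCompacts ℂ) : Set ℂ) ≤ Real.exp (-s)} =
        renewalST 6 bottomDatum (fun s ↦ (μ : Measure (NonemptyCompacts ℂ × NonemptyCompacts ℂ)).real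
          {p | conformalRadius ((p.2 : NonemptyCompacts ℂ) : Set ℂ) ≤ Real.exp (-s)}) θ s)
    {R : ℕ → ℝ} {ν : ProbabilityMeasure (NonemptyCompacts ℂ)} (hR : Tendsto R atTop atTop)
    (hν : Tendsto (lswLaw ∘ R) atTop (𝓝 ν)) {t : ℝ} (ht : 0 < t) :
    lswHit 6 (2 * Real.pi) t =
      (ν : Measure (NonemptyCompacts ℂ)).real {K | conformalRadius (K : Set ℂ) ≤ Real.exp (-t)} := by
  obtain ⟨c, μ, hsnd, hsub, h210', htail⟩ := exists_arcCouplings_of_pairLimit_renewal h210 hR hν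
  refine lswHit_two_pi_eq_measureReal_of_arcCoupling_linear ν μ (ae_conformalRadius_pos_of_subseqLimit R ν hR hν)
    hsnd hsub h210' (ζ := -I) (by simp) (θ₁ := 0) (c := c) (γ := 1) (by positivity) (by norm_num)
    (fun θ hθ r hr ↦ ?_) ht
  rw [Real.rpow_one]
  exact htail θ hθ r hr

/-- **`LawlerSchrammWerner2002_hittingPDE`, LSW Thm. 1.2 and Thm. 1.1 from (2.10) at the joint
subsequential limits.** Suppose that for every `θ ∈ (0, 2π)`, every sequence of meshes
`δ_k = 1/R_k → 0` and every weak limit `μ` of the joint laws `lswPairLaw (R_k) θ` of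
`(Q_{δ_k}(θ), Q_{δ_k}(2π))`, the law of the conformal radius of the first coordinate is the
radial-Bessel renewal extension of the trace of the second: for all `s`,
`μ{𝔯(K_θ) ≤ e^{-s}} = renewalST 6 1_{≤0} w_μ θ s`, `w_μ(s) = μ{𝔯(K_{2π}) ≤ e^{-s}}` — LSW's (2.10)
`h(θ, t) = E[h(Y_T^θ, t - T)]`, i.e. their Theorem 2.1 (Smirnov) with the radial `SLE₆` computation
(2.5)–(2.9). Then the named fact `LawlerSchrammWerner2002_hittingPDE`, LSW's Theorem 1.2
(`LawlerSchrammWerner2002_scalingLimitExponent`) and Theorem 1.1 (`oneArm_exponent`) hold: at every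
subsequential weak limit `ν` of `lswLaw`, the joint subsequential limits are arc couplings with
second marginal `ν`, inclusion a.s. and tails `≤ c (2π - θ)/r` at `ζ = -i`
(`exists_arcCouplings_of_pairLimit_renewal`), and `oneArm_exponent_of_subseqArcCoupling_linear'`
applies with `γ = 1 > 1/2`.
[cite: LawlerSchrammWernerEJP2002, Thm. 1.1, Thm. 1.2, §2: Thm. 2.1, (2.2), (2.10), Lemma 2.2, Lemma 2.3] -/
theorem oneArm_exponent_of_pairLimit_renewal
    (h210 : ∀ (θ : ℝ) (R : ℕ → ℝ) (μ : ProbabilityMeasure (NonemptyCompacts ℂ × NonemptyCompacts ℂ)),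
      θ ∈ Ioo 0 (2 * Real.pi) → Tendsto R atTop atTop → Tendsto (fun k ↦ lswPairLaw (R k) θ) atTop (𝓝 μ) →
      ∀ s : ℝ, (μ : Measure (NonemptyCompacts ℂ × NonemptyCompacts ℂ)).real
          {p | conformalRadius ((p.1 : NonemptyCompacts ℂ) : Set ℂ) ≤ Real.exp (-s)} =
        renewalST 6 bottomDatum (fun s ↦ (μ : Measure (NonemptyCompacts ℂ × NonemptyCompacts ℂ)).real
          {p | conformalRadius ((p.2 : NonemptyCompacts ℂ) : Set ℂ) ≤ Real.exp (-s)}) θ s) :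
    LawlerSchrammWerner2002_hittingPDE ∧ LawlerSchrammWerner2002_scalingLimitExponent ∧ oneArm_exponent := by
  refine oneArm_exponent_of_subseqArcCoupling_linear' fun R ν hR hν ↦ ?_
  obtain ⟨c, μ, hsnd, hsub, h210', htail⟩ := exists_arcCouplings_of_pairLimit_renewal h210 hR hν
  refine ⟨μ, hsnd, hsub, h210', ⟨-I, 0, c, 1, by simp, by positivity, by norm_num, fun θ hθ r hr ↦ ?_⟩⟩
  rw [Real.rpow_one]
  exact htail θ hθ r hr

/-- **`LawlerSchrammWerner2002_hittingPDE` from LSW's (2.10) at the joint subsequential limits**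
(`oneArm_exponent_of_pairLimit_renewal`, first component).
[cite: LawlerSchrammWernerEJP2002, §2: Thm. 2.1, (2.2), (2.10), Lemma 2.2, Lemma 2.3] -/
theorem LawlerSchrammWerner2002_hittingPDE_of_pairLimit_renewal
    (h210 : ∀ (θ : ℝ) (R : ℕ → ℝ) (μ : ProbabilityMeasure (NonemptyCompacts ℂ × NonemptyCompacts ℂ)),
      θ ∈ Ioo 0 (2 * Real.pi) → Tendsto R atTop atTop → Tendsto (fun k ↦ lswPairLaw (R k) θ) atTop (𝓝 μ) →
      ∀ s : ℝ, (μ : Measure (NonemptyCompacts ℂ × NonemptyCompacts ℂ)).real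
          {p | conformalRadius ((p.1 : NonemptyCompacts ℂ) : Set ℂ) ≤ Real.exp (-s)} =
        renewalST 6 bottomDatum (fun s ↦ (μ : Measure (NonemptyCompacts ℂ × NonemptyCompacts ℂ)).real
          {p | conformalRadius ((p.2 : NonemptyCompacts ℂ) : Set ℂ) ≤ Real.exp (-s)}) θ s) :
    LawlerSchrammWerner2002_hittingPDE :=
  (oneArm_exponent_of_pairLimit_renewal h210).1

end Literature.Probability.Percolation
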